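import Mathlib
import Summits.ValiantsHypothesis.ValiantsHypothesis.Theorems.ValuativeGCTValuativeFlipCyclicContinuant

/-!
# Three-term identities of the cofactor pieces (crux `ValuativeGCT.ValuativeFlip`, stub `stub_fourRowPencilRank`)

The exact three-term recursions (E1)–(E4) of `Cruxes/ValuativeFlip/AxisK9G1a2CyclicTridiagonal.md`
§3 for the cofactor pieces `Tw`, `Sw` of the cyclic tridiagonal matrix (file `…Continuant`),
over any commutative ring; they drive the membership chains of P2 (file `…CyclicMembership`):

* `Tw_rowRec` (E2): `m_{j+d} · Tw j d = l_{j+d+1} · Tw j (d+1) + m'_{j+d+2} · Tw j (d+2)`;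
* `Tw_colRec` (E4): `m_{J-1} · Tw J d = l_{J-1} · Tw (J-1) (d+1) + m'_{J-1} · Tw (J-2) (d+2)`;
* `Sw_rowRec` (E1): `m'_i · Sw i e = l_{i-1} · Sw (i-1) (e+1) + m_{i-2} · Sw (i-2) (e+2)`;
* `Sw_colRec` (E3): `m'_{i+e+1} · Sw i e = l_{i+e+1} · Sw i (e+1) + m_{i+e+1} · Sw i (e+2)`;
all for `d + 3 ≤ n` (resp. `e + 3 ≤ n`), plus the two-term boundary forms at length `n - 2`
(`Tw_rowRec_top`, …) and the values at length `0` and `n - 1` (`Tw_zero`, `Sw_zero`, `Tw_top`,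
`Sw_top`).  Each is one application of a continuant recursion (`kont_left` / `kont_rec`) and `ring`.
[this crux]
-/

set_option linter.dupNamespace false

namespace Summit.ValiantsHypothesis.ValiantsHypothesis.Theorems.ValuativeFlip

open scoped BigOperators

section identities

variable {R : Type*} [CommRing R] {n : ℕ} (l m m' : ZMod n → R)

/-- `Tw q 0 = K(q+1, n-1)` (the diagonal cofactor). [this crux] -/
theorem Tw_zero (q : ZMod n) : Tw l m m' q 0 = kont l m m' (q + 1) (n - 1) := by
  unfold Tw; simp

/-- `Sw q 0 = K(q+1, n-1)`. [this crux] -/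
theorem Sw_zero (q : ZMod n) : Sw l m m' q 0 = kont l m m' (q + 1) (n - 1) := by
  unfold Sw; simp

/-- `Tw q (n-1) = m_q ⋯ m_{q+n-2}` (the clockwise Hamiltonian path). [this crux] -/
theorem Tw_top (q : ZMod n) : Tw l m m' q (n - 1) = cstr m q (n - 1) := by
  unfold Tw
  rw [show n - 1 - (n - 1) = 0 by omega, kont_zero, mul_one]

/-- `Sw q (n-1) = m'_{q+1} ⋯ m'_{q+n-1}`. [this crux] -/
theorem Sw_top (q : ZMod n) : Sw l m m' q (n - 1) = cstr m' (q + 1) (n - 1) := by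
  unfold Sw
  rw [show n - 1 - (n - 1) = 0 by omega, kont_zero, mul_one]

/-- **(E2) row recursion of the clockwise pieces**:
`m_{j+d} Tw j d = l_{j+d+1} Tw j (d+1) + m'_{j+d+2} Tw j (d+2)` for `d + 3 ≤ n`. [this crux] -/
theorem Tw_rowRec (j : ZMod n) (d : ℕ) (hd : d + 3 ≤ n) :
    m (j + (d : ZMod n)) * Tw l m m' j d =
      l (j + ((d + 1 : ℕ) : ZMod n)) * Tw l m m' j (d + 1) +
      m' (j + ((d + 2 : ℕ) : ZMod n)) * Tw l m m' j (d + 2) := by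
  obtain ⟨L, hL⟩ : ∃ L, n = d + 3 + L := ⟨n - (d + 3), by omega⟩
  have t0 : Tw l m m' j d = cstr m j d * kont l m m' (j + ((d + 1 : ℕ) : ZMod n)) (L + 2) := by
    unfold Tw; rw [show n - 1 - d = L + 2 by omega]
  have t1 : Tw l m m' j (d + 1) =
      cstr m j d * m (j + (d : ZMod n)) * kont l m m' (j + ((d + 2 : ℕ) : ZMod n)) (L + 1) := by
    unfold Tw
    rw [cstr_succ, show n - 1 - (d + 1) = L + 1 by omega,
      show j + ((d + 1 + 1 : ℕ) : ZMod n) = j + ((d + 2 : ℕ) : ZMod n) by push_cast; ring]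
  have t2 : Tw l m m' j (d + 2) = cstr m j d * m (j + (d : ZMod n)) * m (j + ((d + 1 : ℕ) : ZMod n)) *
      kont l m m' (j + ((d + 3 : ℕ) : ZMod n)) L := by
    unfold Tw
    rw [cstr_succ, cstr_succ, show n - 1 - (d + 2) = L by omega,
      show j + ((d + 2 + 1 : ℕ) : ZMod n) = j + ((d + 3 : ℕ) : ZMod n) by push_cast; ring]
  have kr : kont l m m' (j + ((d + 1 : ℕ) : ZMod n)) (L + 2) =
      l (j + ((d + 1 : ℕ) : ZMod n)) * kont l m m' (j + ((d + 2 : ℕ) : ZMod n)) (L + 1) +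
      m (j + ((d + 1 : ℕ) : ZMod n)) * m' (j + ((d + 2 : ℕ) : ZMod n)) *
        kont l m m' (j + ((d + 3 : ℕ) : ZMod n)) L :=
    kont_left_rec l m m' _ L (by push_cast; ring) (by push_cast; ring)
  rw [t0, t1, t2, kr]
  ring

/-- (E2) at the top length `d = n - 2` (two terms): `m_{j-2} Tw j (n-2) = l_{j-1} Tw j (n-1)`.
[this crux] -/
theorem Tw_rowRec_top (hn : 2 ≤ n) (j : ZMod n) :
    m (j - 2) * Tw l m m' j (n - 2) = l (j - 1) * Tw l m m' j (n - 1) := by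
  have h0 : ((n : ℕ) : ZMod n) = 0 := ZMod.natCast_self n
  have e1 : j + ((n - 2 + 1 : ℕ) : ZMod n) = j - 1 := by
    rw [show n - 2 + 1 = n - 1 by omega, Nat.cast_sub (by omega), h0, Nat.cast_one]; ring
  have e2 : j + ((n - 2 : ℕ) : ZMod n) = j - 2 := by
    rw [Nat.cast_sub hn, h0]; push_cast; ring
  rw [Tw_top, show n - 1 = n - 2 + 1 by omega, cstr_succ, e2]
  unfold Tw
  rw [show n - 1 - (n - 2) = 1 by omega, kont_one, e1]
  ring

/-- **(E4) column recursion of the clockwise pieces**: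
`m_{J-1} Tw J d = l_{J-1} Tw (J-1) (d+1) + m'_{J-1} Tw (J-2) (d+2)` for `d + 3 ≤ n`. [this crux] -/
theorem Tw_colRec (J : ZMod n) (d : ℕ) (hd : d + 3 ≤ n) :
    m (J - 1) * Tw l m m' J d =
      l (J - 1) * Tw l m m' (J - 1) (d + 1) + m' (J - 1) * Tw l m m' (J - 2) (d + 2) := by
  obtain ⟨L, hL⟩ : ∃ L, n = d + 3 + L := ⟨n - (d + 3), by omega⟩
  have h0 : ((d + 3 + L : ℕ) : ZMod n) = 0 := by rw [← hL, ZMod.natCast_self]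
  set b : ZMod n := J + ((d + 1 : ℕ) : ZMod n) with hb
  have t0 : Tw l m m' J d = cstr m J d * kont l m m' b (L + 2) := by
    unfold Tw; rw [show n - 1 - d = L + 2 by omega]
  have t1 : Tw l m m' (J - 1) (d + 1) = m (J - 1) * cstr m J d * kont l m m' b (L + 1) := by
    unfold Tw
    rw [cstr_succ_left, sub_add_cancel, show n - 1 - (d + 1) = L + 1 by omega,
      show J - 1 + ((d + 1 + 1 : ℕ) : ZMod n) = b by rw [hb]; push_cast; ring]
  have t2 : Tw l m m' (J - 2) (d + 2) = m (J - 2) * m (J - 1) * cstr m J d * kont l m m' b L := by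
    unfold Tw
    rw [cstr_succ_left, cstr_succ_left, show J - 2 + 1 = J - 1 by ring, sub_add_cancel,
      show n - 1 - (d + 2) = L by omega,
      show J - 2 + ((d + 2 + 1 : ℕ) : ZMod n) = b by rw [hb]; push_cast; ring]
    ring
  have kr : kont l m m' b (L + 2) = l (J - 1) * kont l m m' b (L + 1) +
      m (J - 2) * m' (J - 1) * kont l m m' b L :=
    kont_rec l m m' b L (by rw [hb]; push_cast at h0 ⊢; linear_combination -h0)
      (by rw [hb]; push_cast at h0 ⊢; linear_combination -h0)
  rw [t0, t1, t2, kr]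
  ring

/-- (E4) at the top length (two terms): `m_{J-1} Tw J (n-2) = l_{J-1} Tw (J-1) (n-1)`.
[this crux] -/
theorem Tw_colRec_top (hn : 2 ≤ n) (J : ZMod n) :
    m (J - 1) * Tw l m m' J (n - 2) = l (J - 1) * Tw l m m' (J - 1) (n - 1) := by
  have h0 : ((n : ℕ) : ZMod n) = 0 := ZMod.natCast_self n
  rw [Tw_top, show n - 1 = n - 2 + 1 by omega, cstr_succ_left, sub_add_cancel]
  unfold Tw
  rw [show n - 1 - (n - 2) = 1 by omega, kont_one,
    show J + ((n - 2 + 1 : ℕ) : ZMod n) = J - 1 by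
      rw [show n - 2 + 1 = n - 1 by omega, Nat.cast_sub (by omega), h0, Nat.cast_one]; ring]
  ring

/-- **(E1) row recursion of the counter-clockwise pieces**:
`m'_i Sw i e = l_{i-1} Sw (i-1) (e+1) + m_{i-2} Sw (i-2) (e+2)` for `e + 3 ≤ n`. [this crux] -/
theorem Sw_rowRec (i : ZMod n) (e : ℕ) (he : e + 3 ≤ n) :
    m' i * Sw l m m' i e =
      l (i - 1) * Sw l m m' (i - 1) (e + 1) + m (i - 2) * Sw l m m' (i - 2) (e + 2) := by
  obtain ⟨L, hL⟩ : ∃ L, n = e + 3 + L := ⟨n - (e + 3), by omega⟩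
  have h0 : ((e + 3 + L : ℕ) : ZMod n) = 0 := by rw [← hL, ZMod.natCast_self]
  set a : ZMod n := i + ((e + 1 : ℕ) : ZMod n) with ha
  have s0 : Sw l m m' i e = cstr m' (i + 1) e * kont l m m' a (L + 2) := by
    unfold Sw; rw [show n - 1 - e = L + 2 by omega]
  have s1 : Sw l m m' (i - 1) (e + 1) = m' i * cstr m' (i + 1) e * kont l m m' a (L + 1) := by
    unfold Sw
    rw [sub_add_cancel, cstr_succ_left, show n - 1 - (e + 1) = L + 1 by omega,
      show i - 1 + ((e + 1 + 1 : ℕ) : ZMod n) = a by rw [ha]; push_cast; ring]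
  have s2 : Sw l m m' (i - 2) (e + 2) = m' (i - 1) * m' i * cstr m' (i + 1) e * kont l m m' a L := by
    unfold Sw
    rw [show i - 2 + 1 = i - 1 by ring, cstr_succ_left, sub_add_cancel, cstr_succ_left,
      show n - 1 - (e + 2) = L by omega,
      show i - 2 + ((e + 2 + 1 : ℕ) : ZMod n) = a by rw [ha]; push_cast; ring]
    ring
  have kr : kont l m m' a (L + 2) = l (i - 1) * kont l m m' a (L + 1) +
      m (i - 2) * m' (i - 1) * kont l m m' a L :=
    kont_rec l m m' a L (by rw [ha]; push_cast at h0 ⊢; linear_combination -h0)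
      (by rw [ha]; push_cast at h0 ⊢; linear_combination -h0)
  rw [s0, s1, s2, kr]
  ring

/-- (E1) at the top length (two terms): `m'_i Sw i (n-2) = l_{i-1} Sw (i-1) (n-1)`. [this crux] -/
theorem Sw_rowRec_top (hn : 2 ≤ n) (i : ZMod n) :
    m' i * Sw l m m' i (n - 2) = l (i - 1) * Sw l m m' (i - 1) (n - 1) := by
  have h0 : ((n : ℕ) : ZMod n) = 0 := ZMod.natCast_self n
  rw [Sw_top, sub_add_cancel, show n - 1 = n - 2 + 1 by omega, cstr_succ_left]
  unfold Sw
  rw [show n - 1 - (n - 2) = 1 by omega, kont_one,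
    show i + ((n - 2 + 1 : ℕ) : ZMod n) = i - 1 by
      rw [show n - 2 + 1 = n - 1 by omega, Nat.cast_sub (by omega), h0, Nat.cast_one]; ring]
  ring

/-- **(E3) column recursion of the counter-clockwise pieces**:
`m'_{i+e+1} Sw i e = l_{i+e+1} Sw i (e+1) + m_{i+e+1} Sw i (e+2)` for `e + 3 ≤ n`. [this crux] -/
theorem Sw_colRec (i : ZMod n) (e : ℕ) (he : e + 3 ≤ n) :
    m' (i + ((e + 1 : ℕ) : ZMod n)) * Sw l m m' i e =
      l (i + ((e + 1 : ℕ) : ZMod n)) * Sw l m m' i (e + 1) +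
      m (i + ((e + 1 : ℕ) : ZMod n)) * Sw l m m' i (e + 2) := by
  obtain ⟨L, hL⟩ : ∃ L, n = e + 3 + L := ⟨n - (e + 3), by omega⟩
  have s0 : Sw l m m' i e = cstr m' (i + 1) e * kont l m m' (i + ((e + 1 : ℕ) : ZMod n)) (L + 2) := by
    unfold Sw; rw [show n - 1 - e = L + 2 by omega]
  have s1 : Sw l m m' i (e + 1) = cstr m' (i + 1) e * m' (i + ((e + 1 : ℕ) : ZMod n)) *
      kont l m m' (i + ((e + 2 : ℕ) : ZMod n)) (L + 1) := by
    unfold Sw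
    rw [cstr_succ, show n - 1 - (e + 1) = L + 1 by omega,
      show i + ((e + 1 + 1 : ℕ) : ZMod n) = i + ((e + 2 : ℕ) : ZMod n) by push_cast; ring,
      show i + 1 + (e : ZMod n) = i + ((e + 1 : ℕ) : ZMod n) by push_cast; ring]
  have s2 : Sw l m m' i (e + 2) = cstr m' (i + 1) e * m' (i + ((e + 1 : ℕ) : ZMod n)) *
      m' (i + ((e + 2 : ℕ) : ZMod n)) * kont l m m' (i + ((e + 3 : ℕ) : ZMod n)) L := by
    unfold Sw
    rw [cstr_succ, cstr_succ, show n - 1 - (e + 2) = L by omega,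
      show i + ((e + 2 + 1 : ℕ) : ZMod n) = i + ((e + 3 : ℕ) : ZMod n) by push_cast; ring,
      show i + 1 + (e : ZMod n) = i + ((e + 1 : ℕ) : ZMod n) by push_cast; ring,
      show i + 1 + ((e + 1 : ℕ) : ZMod n) = i + ((e + 2 : ℕ) : ZMod n) by push_cast; ring]
  have kr : kont l m m' (i + ((e + 1 : ℕ) : ZMod n)) (L + 2) =
      l (i + ((e + 1 : ℕ) : ZMod n)) * kont l m m' (i + ((e + 2 : ℕ) : ZMod n)) (L + 1) +
      m (i + ((e + 1 : ℕ) : ZMod n)) * m' (i + ((e + 2 : ℕ) : ZMod n)) *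
        kont l m m' (i + ((e + 3 : ℕ) : ZMod n)) L :=
    kont_left_rec l m m' _ L (by push_cast; ring) (by push_cast; ring)
  rw [s0, s1, s2, kr]
  ring

/-- (E3) at the top length (two terms): `m'_{i-1} Sw i (n-2) = l_{i-1} Sw i (n-1)`. [this crux] -/
theorem Sw_colRec_top (hn : 2 ≤ n) (i : ZMod n) :
    m' (i - 1) * Sw l m m' i (n - 2) = l (i - 1) * Sw l m m' i (n - 1) := by
  have h0 : ((n : ℕ) : ZMod n) = 0 := ZMod.natCast_self n
  have e2 : i + 1 + ((n - 2 : ℕ) : ZMod n) = i - 1 := by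
    rw [Nat.cast_sub hn, h0]; push_cast; ring
  rw [Sw_top, show n - 1 = n - 2 + 1 by omega, cstr_succ, e2]
  unfold Sw
  rw [show n - 1 - (n - 2) = 1 by omega, kont_one,
    show i + ((n - 2 + 1 : ℕ) : ZMod n) = i - 1 by
      rw [show n - 2 + 1 = n - 1 by omega, Nat.cast_sub (by omega), h0, Nat.cast_one]; ring]
  ring

end identities

end Summit.ValiantsHypothesis.ValiantsHypothesis.Theorems.ValuativeFlip
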